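import Summits.CriticalPhenomena.SAWScalingLimit.Theses.SAWTotalPositivity
import Summits.CriticalPhenomena.SAWScalingLimit.Theorems.SAWTotalPositivityBoundaryTP2Defs
import Summits.CriticalPhenomena.SAWScalingLimit.Theorems.SAWTotalPositivityBoundaryTP2Kernel
import Summits.CriticalPhenomena.SAWScalingLimit.Theorems.SAWTotalPositivityBoundaryTP2Symmetry
import Summits.CriticalPhenomena.SAWScalingLimit.Theorems.SAWTotalPositivityBoundaryTP2RectBottomRow
import Summits.CriticalPhenomena.SAWScalingLimit.Theorems.SAWTotalPositivityBoundaryTP2LadderBottomRowNested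
import Summits.CriticalPhenomena.SAWScalingLimit.Theorems.SAWTotalPositivityBoundaryTP2LadderBottomRowAdjacent
import Summits.CriticalPhenomena.SAWScalingLimit.Theorems.EdgeOfPositivity.Negative.EdgeOfPositivityRectDomain
import Literature.Probability.RandomPlanarGeometry.SelfAvoidingWalkProofs
import HarnessLib

/-!
# Crux `BoundaryTP2` (stmt-CriticalPhenomena-7115): four sites on one side of EVERY ladder

Line `Sketch`, lead c5 (wave 3 composition).  For the ladder `{0,…,L} × {0,1}` — the discrete domain at mesh `1`
of the open rectangle `rectDomain L 1` — and any four bottom sites `(c₁,0), (c₂,0), (c₃,0), (c₄,0)` with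
`c₁ < c₂ < c₃ < c₄ ≤ L`, the crux `BoundaryTP2` holds AS TYPED in both labellings of the cyclic order: the three
hypotheses (interlacing and the two disjoint realisations, `stub_rect_bottomRow`) hold, and both conclusions
`Z₁₃Z₂₄ ≤ Z₁₂Z₃₄` (`stub_ladder_bottomRow_adjacent`) and `Z₁₃Z₂₄ ≤ Z₁₄Z₂₃` (`stub_ladder_bottomRow_nested`) hold at
`x_c` (indeed at every `x ≤ 1/2`).  This is the asymptotically TIGHTEST family of the crux found numerically
(clustered pairs at the two ends of one side: margins `→ 0⁺` geometrically in the separation), and here its sign is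
a theorem with an exact mechanism: in the rank-two form of the ladder kernel the nested minor is the product of two
local orientation determinants (lead c3's effective-position picture, exact on the ladder).
-/

noncomputable section

namespace Summit.CriticalPhenomena.SAWScalingLimit.Theorems.BoundaryTP2

open Literature.Probability.LatticeModels Literature.Probability.RandomPlanarGeometry
open Summit.CriticalPhenomena.SAWScalingLimit.Theorems.EdgeOfPositivity.Negative
open scoped ENNReal

/-- **`BoundaryTP2` for four sites on one side of every ladder, adjacent labelling.** For `Ω = rectDomain L 1`,
`δ = 1` and bottom sites `p_k = (c_k, 0)` with `c₁ < c₂ < c₃ < c₄ ≤ L`, the three hypotheses of the crux hold as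
typed for `(p₁,p₂,p₃,p₄)` and its conclusion holds: `Z(p₁,p₃) Z(p₂,p₄) ≤ Z(p₁,p₂) Z(p₃,p₄)`. [folklore] -/
theorem ladder_boundaryTP2_bottomRow_adjacent (L : ℕ) {c₁ c₂ c₃ c₄ : ℕ} (h₁₂ : c₁ < c₂) (h₂₃ : c₂ < c₃)
    (h₃₄ : c₃ < c₄) (h₄ : c₄ ≤ L) :
    (∀ (P : SAW.DomainSAW (rectDomain L 1) 1 (st c₁ 0) (st c₃ 0))
        (Q : SAW.DomainSAW (rectDomain L 1) 1 (st c₂ 0) (st c₄ 0)),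
        ∃ v, v ∈ P.walk.support ∧ v ∈ Q.walk.support) ∧
    (∃ (P : SAW.DomainSAW (rectDomain L 1) 1 (st c₁ 0) (st c₂ 0))
        (Q : SAW.DomainSAW (rectDomain L 1) 1 (st c₃ 0) (st c₄ 0)),
        List.Disjoint P.walk.support Q.walk.support) ∧
    (∃ (P : SAW.DomainSAW (rectDomain L 1) 1 (st c₁ 0) (st c₄ 0))
        (Q : SAW.DomainSAW (rectDomain L 1) 1 (st c₂ 0) (st c₃ 0)),
        List.Disjoint P.walk.support Q.walk.support) ∧
    SAW.weight (rectDomain L 1) 1 (st c₁ 0) (st c₃ 0) Set.univ *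
        SAW.weight (rectDomain L 1) 1 (st c₂ 0) (st c₄ 0) Set.univ ≤
      SAW.weight (rectDomain L 1) 1 (st c₁ 0) (st c₂ 0) Set.univ *
        SAW.weight (rectDomain L 1) 1 (st c₃ 0) (st c₄ 0) Set.univ := by
  obtain ⟨hI, hD₁, hD₂⟩ := stub_rect_bottomRow L 1 le_rfl h₁₂ h₂₃ h₃₄ h₄
  refine ⟨fun P Q => hI ⟨P.walk, P.isPath⟩ ⟨Q.walk, Q.isPath⟩, ?_, ?_, ?_⟩
  · obtain ⟨P, Q, hPQ⟩ := hD₁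
    exact ⟨⟨P.1, P.2⟩, ⟨Q.1, Q.2⟩, by simpa using hPQ⟩
  · obtain ⟨P, Q, hPQ⟩ := hD₂
    exact ⟨⟨P.1, P.2⟩, ⟨Q.1, Q.2⟩, by simpa using hPQ⟩
  · simp only [weight_univ_eq_pathKernel]
    exact stub_ladder_bottomRow_adjacent L h₁₂ h₂₃ h₃₄ h₄ SAW.criticalFugacity_pos_lt_one'.1.le
      SAW.criticalFugacity_le_half

/-- **`BoundaryTP2` for four sites on one side of every ladder, nested labelling.** For `Ω = rectDomain L 1`,
`δ = 1` and bottom sites `c₁ < c₂ < c₃ < c₄ ≤ L`, relabelled `(p₁,p₂,p₃,p₄) = ((c₁,0),(c₄,0),(c₃,0),(c₂,0))`, the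
three hypotheses of the crux hold as typed and its conclusion holds:
`Z((c₁,0),(c₃,0)) Z((c₄,0),(c₂,0)) ≤ Z((c₁,0),(c₄,0)) Z((c₃,0),(c₂,0))` (crossing ≤ nested). [folklore] -/
theorem ladder_boundaryTP2_bottomRow_nested (L : ℕ) {c₁ c₂ c₃ c₄ : ℕ} (h₁₂ : c₁ < c₂) (h₂₃ : c₂ < c₃)
    (h₃₄ : c₃ < c₄) (h₄ : c₄ ≤ L) :
    (∀ (P : SAW.DomainSAW (rectDomain L 1) 1 (st c₁ 0) (st c₃ 0))
        (Q : SAW.DomainSAW (rectDomain L 1) 1 (st c₄ 0) (st c₂ 0)),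
        ∃ v, v ∈ P.walk.support ∧ v ∈ Q.walk.support) ∧
    (∃ (P : SAW.DomainSAW (rectDomain L 1) 1 (st c₁ 0) (st c₄ 0))
        (Q : SAW.DomainSAW (rectDomain L 1) 1 (st c₃ 0) (st c₂ 0)),
        List.Disjoint P.walk.support Q.walk.support) ∧
    (∃ (P : SAW.DomainSAW (rectDomain L 1) 1 (st c₁ 0) (st c₂ 0))
        (Q : SAW.DomainSAW (rectDomain L 1) 1 (st c₄ 0) (st c₃ 0)),
        List.Disjoint P.walk.support Q.walk.support) ∧
    SAW.weight (rectDomain L 1) 1 (st c₁ 0) (st c₃ 0) Set.univ *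
        SAW.weight (rectDomain L 1) 1 (st c₄ 0) (st c₂ 0) Set.univ ≤
      SAW.weight (rectDomain L 1) 1 (st c₁ 0) (st c₄ 0) Set.univ *
        SAW.weight (rectDomain L 1) 1 (st c₃ 0) (st c₂ 0) Set.univ := by
  obtain ⟨hI, hD₁, hD₂⟩ := stub_rect_bottomRow L 1 le_rfl h₁₂ h₂₃ h₃₄ h₄
  refine ⟨fun P Q => hI.reverse_right ⟨P.walk, P.isPath⟩ ⟨Q.walk, Q.isPath⟩, ?_, ?_, ?_⟩
  · obtain ⟨P, Q, hPQ⟩ := hD₂.reverse_right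
    exact ⟨⟨P.1, P.2⟩, ⟨Q.1, Q.2⟩, by simpa using hPQ⟩
  · obtain ⟨P, Q, hPQ⟩ := hD₁.reverse_right
    exact ⟨⟨P.1, P.2⟩, ⟨Q.1, Q.2⟩, by simpa using hPQ⟩
  · simp only [weight_univ_eq_pathKernel]
    rw [pathKernel_comm _ _ (st c₄ 0) (st c₂ 0), pathKernel_comm _ _ (st c₃ 0) (st c₂ 0)]
    exact stub_ladder_bottomRow_nested L h₁₂ h₂₃ h₃₄ h₄ SAW.criticalFugacity_pos_lt_one'.1.le
      SAW.criticalFugacity_le_half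

end Summit.CriticalPhenomena.SAWScalingLimit.Theorems.BoundaryTP2
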